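import Literature.NumberTheory.Transcendental.CurvePeriodsGmLoopsProofs
import HarnessLib

/-!
# Periods of curve type: arbitrary paths on `𝔾ₘ` and the calculus of logarithm symbols

Companion of `Literature/NumberTheory/Transcendental/CurvePeriods.lean` (Huber–Wüstholz 2022,
Thm. 13.3 (2), rendered on explicit period symbols with the elementary relations (R1)–(R5)) and
of `CurvePeriodsGmLoopsProofs.lean` (closed paths on `𝔾ₘ = {xy = 1}`). Here the paths are
arbitrary `C¹` paths on `𝔾ₘ` with algebraic end points, whose periods `∫ y dx = ∫ dx/x` are
logarithms of algebraic numbers. We prove, inside the relation module, the calculus that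
reduces every such symbol to the **logarithm symbols**
`ℓ(M) = (𝔾ₘ, y dx, E_{0,M})`, `E_{L₀,L₁}(t) = (e^{(1−t)L₀ + tL₁}, e^{−(1−t)L₀ − tL₁})`, `e^M ∈ ℚ̄`:

* `exists_expPath`, `period_ydx_expPath` (`∫_{E_{L₀,L₁}} y dx = L₁ − L₀`);
* `exists_single_path_eq_single_expPath` — every path is (R5)-equivalent to the exponential
  path with the same end points and the same logarithm increment (explicit `C¹` homotopy,
  two triangles, as for loops);
* `rel_expPath_baseChange` — `(y dx, E_{L₀,L₁}) ∼ (y dx, E_{0,L₁−L₀})` ((R4) along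
  `(x, y) ↦ (e^{−L₀}x, e^{L₀}y)`);
* `rel_expPath_concat` — `E_{0,A} + E_{A,A+B} − E_{0,A+B}` is a boundary ((R5), the triangle
  `(a, b) ↦ e^{aA + b(A+B)}`), whence the additivity `ℓ(A) + ℓ(B) ∼ ℓ(A + B)`
  (`span_log_add`) and `ℚ`-linearity `ℓ(qM) ∼ q ℓ(M)` (`span_log_natMul`, `span_log_neg`,
  `span_log_ratMul`) of the logarithm symbols modulo the `ℚ̄`-span of the elementary relations.

This is the input for the `𝔾ₘ` case of Theorem 13.3 (2) from Baker's theorem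
(`CurvePeriodsGmBakerProofs.lean`; book Rem. 15.11: "This is precisely Baker's Theorem").

## References

* A. Huber, G. Wüstholz, *Transcendence and Linear Relations of 1-Periods*, Cambridge Tracts in
  Mathematics 227, CUP 2022 [HuberWustholz2022], §3.3.1 (pp. 42–43 of the held text), §10.1
  (p. 96), Thm. 13.3 (2) (p. 121), Rem. 15.11 (p. 151).
-/

noncomputable section

open scoped BigOperators Real
open MvPolynomial Set Complex

namespace Literature.NumberTheory.Transcendental

namespace CurvePeriods

/-- Two `C¹` paths with the same parametrisation are equal. [folklore] -/
theorem CurvePath.eq_of_toFun_eq {Z : CurveData} {γ₁ γ₂ : CurvePath Z}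
    (h : ∀ t, γ₁.toFun t = γ₂.toFun t) : γ₁ = γ₂ := by
  cases γ₁; cases γ₂
  congr
  exact funext h

/-! ### Exponential paths -/

/-- **Exponential paths exist as `C¹` paths on `𝔾ₘ`**: for `e^{L₀}, e^{L₁} ∈ ℚ̄`,
`E_{L₀,L₁}(t) = (e^{(1−t)L₀ + tL₁}, e^{−((1−t)L₀ + tL₁)})` is a `C¹` path on `𝔾ₘ` from `(e^{L₀}, e^{−L₀})`
to `(e^{L₁}, e^{−L₁})`. [folklore] -/
theorem exists_expPath {L₀ L₁ : ℂ} (h₀ : IsAlgebraic ℚ (exp L₀)) (h₁ : IsAlgebraic ℚ (exp L₁)) :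
    ∃ E : CurvePath (⟨2, 1, ![X 0 * X 1 - 1]⟩ : CurveData), ∀ t, E.toFun t =
      ![exp ((1 - t) * L₀ + t * L₁), exp (-((1 - t) * L₀ + t * L₁))] := by
  have h1 : ContDiff ℝ 1 fun t : ℝ => (1 - (t : ℂ)) * L₀ + (t : ℂ) * L₁ :=
    ((contDiff_const.sub ofRealCLM.contDiff).mul contDiff_const).add
      (ofRealCLM.contDiff.mul contDiff_const)
  refine ⟨{ toFun := fun t => ![exp ((1 - t) * L₀ + t * L₁), exp (-((1 - t) * L₀ + t * L₁))]
            contDiffOn := ?_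
            mem_points := ?_
            algebraic_zero := ?_
            algebraic_one := ?_ }, fun t => rfl⟩
  · refine ContDiff.contDiffOn (contDiff_pi.2 fun i => ?_)
    fin_cases i
    · simpa using h1.cexp
    · simpa using h1.neg.cexp
  · intro t _
    rw [mem_points_mulGroup_iff]
    simp only [Matrix.cons_val_zero, Matrix.cons_val_one]
    rw [← exp_add, add_neg_cancel, exp_zero]
  · intro i
    fin_cases i
    · simpa using h₀
    · simpa [exp_neg] using h₀.inv
  · intro i
    fin_cases i
    · simpa using h₁
    · simpa [exp_neg] using h₁.inv

/-- **The period of `y dx` along `E_{L₀,L₁}` is `L₁ − L₀`** (a determination of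
`log (e^{L₁}/e^{L₀})`). [cite: HuberWustholz2022, §10.1 (p. 96)] -/
theorem period_ydx_expPath (L₀ L₁ : ℂ) (E : CurvePath (⟨2, 1, ![X 0 * X 1 - 1]⟩ : CurveData))
    (hE : ∀ t, E.toFun t = ![exp ((1 - t) * L₀ + t * L₁), exp (-((1 - t) * L₀ + t * L₁))]) :
    (⟨⟨2, 1, ![X 0 * X 1 - 1]⟩, isSmoothAffineCurve_mulGroup, ![X 1, 0], hasAlgCoeffs_ydx, E⟩ :
      PeriodSymbol).period = L₁ - L₀ := by
  have hlin : ∀ t : ℝ, HasDerivAt (fun s : ℝ => (1 - (s : ℂ)) * L₀ + (s : ℂ) * L₁) (L₁ - L₀) t := by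
    intro t
    have e : (fun s : ℝ => (1 - (s : ℂ)) * L₀ + (s : ℂ) * L₁) =
        fun s : ℝ => L₀ + (s : ℂ) * (L₁ - L₀) := by
      funext s; ring
    rw [e]
    have h := (((hasDerivAt_id (t : ℂ)).mul_const (L₁ - L₀)).const_add L₀).comp_ofReal
    simpa using h
  have hd : ∀ t : ℝ, HasDerivAt (fun s : ℝ => exp ((1 - (s : ℂ)) * L₀ + (s : ℂ) * L₁))
      (exp ((1 - (t : ℂ)) * L₀ + (t : ℂ) * L₁) * (L₁ - L₀)) t := fun t => (hlin t).cexp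
  have hd' : ∀ t : ℝ, HasDerivAt (fun s : ℝ => exp (-((1 - (s : ℂ)) * L₀ + (s : ℂ) * L₁)))
      (exp (-((1 - (t : ℂ)) * L₀ + (t : ℂ) * L₁)) * -(L₁ - L₀)) t := fun t => (hlin t).neg.cexp
  rw [PeriodSymbol.period_eq_of_hasDerivAt
    ⟨⟨2, 1, ![X 0 * X 1 - 1]⟩, isSmoothAffineCurve_mulGroup, ![X 1, 0], hasAlgCoeffs_ydx, E⟩
    (fun t : ℝ => ![exp ((1 - t) * L₀ + t * L₁), exp (-((1 - t) * L₀ + t * L₁))])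
    (fun t : ℝ => ![exp ((1 - (t : ℂ)) * L₀ + (t : ℂ) * L₁) * (L₁ - L₀),
      exp (-((1 - (t : ℂ)) * L₀ + (t : ℂ) * L₁)) * -(L₁ - L₀)])
    (fun t _ => hE t) (fun t _ i => ?_)]
  · have hconst : ∀ t : ℝ, (∑ i : Fin 2,
        eval (![exp ((1 - t) * L₀ + t * L₁), exp (-((1 - t) * L₀ + t * L₁))] : Fin 2 → ℂ)
          ((![X 1, 0] : Fin 2 → MvPolynomial (Fin 2) ℂ) i) *
        (![exp ((1 - (t : ℂ)) * L₀ + (t : ℂ) * L₁) * (L₁ - L₀),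
          exp (-((1 - (t : ℂ)) * L₀ + (t : ℂ) * L₁)) * -(L₁ - L₀)] : Fin 2 → ℂ) i) = L₁ - L₀ := by
      intro t
      rw [Fin.sum_univ_two]
      simp only [Matrix.cons_val_zero, Matrix.cons_val_one, eval_X, map_zero, zero_mul, add_zero]
      rw [← mul_assoc, ← exp_add, neg_add_cancel, exp_zero, one_mul]
    simp_rw [hconst]
    simp
  · fin_cases i
    · exact hd t
    · exact hd' t

/-! ### Every path on `𝔾ₘ` is (R5)-equivalent to an exponential path -/

/-- **A `C¹` path on `𝔾ₘ` is (R5)-equivalent to the exponential path with the same end points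
and logarithm increment.** If `L` is a `C¹` logarithm of the first coordinate of `γ`
(`exp (L t) = γ(t)₀` on `[0,1]`), then `(𝔾ₘ, ω, γ) = (𝔾ₘ, ω, E_{L(0),L(1)}) + ρ₃ + ρ₄ − ρ₁ − ρ₂`
with `ρ₁, …, ρ₄` elementary (two boundaries of `C¹` triangles cut from the homotopy
`(e^{ℓ}, e^{−ℓ})`, `ℓ(s,t) = (1 − s)L(t) + s((1−t)L(0) + tL(1))`, and the two constant paths at
the end points). [cite: HuberWustholz2022, §3.3.1 (pp. 42–43)] -/
theorem single_path_eq_single_expPath (ω : Fin 2 → MvPolynomial (Fin 2) ℂ)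
    (h : ∀ i, HasAlgCoeffs (ω i)) (γ : CurvePath (⟨2, 1, ![X 0 * X 1 - 1]⟩ : CurveData))
    (L : ℝ → ℂ) (hL : ContDiff ℝ 1 L) (hLx : ∀ t ∈ Icc (0 : ℝ) 1, exp (L t) = γ.toFun t 0) :
    ∃ (E : CurvePath (⟨2, 1, ![X 0 * X 1 - 1]⟩ : CurveData)) (ρ₁ ρ₂ ρ₃ ρ₄ : PeriodSymbol →₀ ℂ),
      (∀ t, E.toFun t = ![exp ((1 - t) * L 0 + t * L 1), exp (-((1 - t) * L 0 + t * L 1))]) ∧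
      IsElementaryRelation ρ₁ ∧ IsElementaryRelation ρ₂ ∧ IsElementaryRelation ρ₃ ∧
      IsElementaryRelation ρ₄ ∧
      Finsupp.single (⟨⟨2, 1, ![X 0 * X 1 - 1]⟩, isSmoothAffineCurve_mulGroup, ω, h, γ⟩ :
          PeriodSymbol) (1 : ℂ) =
        Finsupp.single (⟨⟨2, 1, ![X 0 * X 1 - 1]⟩, isSmoothAffineCurve_mulGroup, ω, h, E⟩ :
          PeriodSymbol) (1 : ℂ) + (ρ₃ + ρ₄ - ρ₁ - ρ₂) := by
  have h0I : (0 : ℝ) ∈ Icc (0 : ℝ) 1 := ⟨le_rfl, zero_le_one⟩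
  have h1I : (1 : ℝ) ∈ Icc (0 : ℝ) 1 := ⟨zero_le_one, le_rfl⟩
  have hprod : ∀ t ∈ Icc (0 : ℝ) 1, γ.toFun t 0 * γ.toFun t 1 = 1 := fun t ht =>
    (mem_points_mulGroup_iff _).1 (γ.mem_points t ht)
  have hy : ∀ t ∈ Icc (0 : ℝ) 1, γ.toFun t 1 = (γ.toFun t 0)⁻¹ := fun t ht =>
    eq_inv_of_mul_eq_one_right (hprod t ht)
  have hL0 : exp (L 0) = γ.toFun 0 0 := hLx 0 h0I
  have hL1 : exp (L 1) = γ.toFun 1 0 := hLx 1 h1I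
  -- the homotopy
  obtain ⟨ℓ, hℓ⟩ : ∃ ℓ : ℝ × ℝ → ℂ, ℓ = fun q =>
      (1 - (q.1 : ℂ)) * L q.2 + (q.1 : ℂ) * ((1 - (q.2 : ℂ)) * L 0 + (q.2 : ℂ) * L 1) := ⟨_, rfl⟩
  have hℓC : ContDiff ℝ 1 ℓ := by
    rw [hℓ]
    have h1 : ContDiff ℝ 1 fun q : ℝ × ℝ => (q.1 : ℂ) := ofRealCLM.contDiff.comp contDiff_fst
    have h2 : ContDiff ℝ 1 fun q : ℝ × ℝ => (q.2 : ℂ) := ofRealCLM.contDiff.comp contDiff_snd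
    have h3 : ContDiff ℝ 1 fun q : ℝ × ℝ => L q.2 := hL.comp contDiff_snd
    exact ((contDiff_const.sub h1).mul h3).add
      (h1.mul (((contDiff_const.sub h2).mul contDiff_const).add (h2.mul contDiff_const)))
  obtain ⟨H, hH⟩ : ∃ H : ℝ × ℝ → (Fin 2 → ℂ), H = fun q => ![exp (ℓ q), exp (-ℓ q)] :=
    ⟨_, rfl⟩
  have hHC : ContDiff ℝ 1 H := by
    rw [hH]
    refine contDiff_pi.2 fun i => ?_
    fin_cases i
    · simpa using hℓC.cexp
    · simpa using hℓC.neg.cexp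
  have hHmem : ∀ q, H q ∈ (⟨2, 1, ![X 0 * X 1 - 1]⟩ : CurveData).points := fun q => by
    rw [hH, mem_points_mulGroup_iff]
    simp only [Matrix.cons_val_zero, Matrix.cons_val_one]
    rw [← exp_add, add_neg_cancel, exp_zero]
  -- values of `ℓ` on the edges of the square
  have hℓ_s0 : ∀ s : ℝ, ℓ (s, 0) = L 0 := fun s => by
    rw [hℓ]; push_cast; ring
  have hℓ_s1 : ∀ s : ℝ, ℓ (s, 1) = L 1 := fun s => by
    rw [hℓ]; push_cast; ring
  have hℓ_1t : ∀ t : ℝ, ℓ (1, t) = (1 - (t : ℂ)) * L 0 + (t : ℂ) * L 1 := fun t => by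
    rw [hℓ]; push_cast; ring
  have hℓ_0t : ∀ t : ℝ, ℓ (0, t) = L t := fun t => by
    rw [hℓ]; push_cast; ring
  -- values of `H` on the edges of the square
  have hP0 : (![exp (L 0), exp (-L 0)] : Fin 2 → ℂ) = γ.toFun 0 := by
    funext i
    fin_cases i
    · simpa using hL0
    · simpa [exp_neg, hL0] using (hy 0 h0I).symm
  have hP1 : (![exp (L 1), exp (-L 1)] : Fin 2 → ℂ) = γ.toFun 1 := by
    funext i
    fin_cases i
    · simpa using hL1
    · simpa [exp_neg, hL1] using (hy 1 h1I).symm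
  have hH_s0 : ∀ s : ℝ, H (s, 0) = γ.toFun 0 := fun s => by
    rw [hH, ← hP0]
    simp only [hℓ_s0]
  have hH_s1 : ∀ s : ℝ, H (s, 1) = γ.toFun 1 := fun s => by
    rw [hH, ← hP1]
    simp only [hℓ_s1]
  have hH_0t : ∀ t ∈ Icc (0 : ℝ) 1, H (0, t) = γ.toFun t := fun t ht => by
    rw [hH]
    funext i
    fin_cases i
    · simpa [hℓ_0t] using hLx t ht
    · simpa [hℓ_0t, exp_neg, hLx t ht] using (hy t ht).symm
  -- the constant paths, the exponential path and the diagonal of the homotopy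
  let κ₀ : CurvePath (⟨2, 1, ![X 0 * X 1 - 1]⟩ : CurveData) :=
    { toFun := fun _ => γ.toFun 0
      contDiffOn := contDiffOn_const
      mem_points := fun _ _ => γ.mem_points 0 h0I
      algebraic_zero := γ.algebraic_zero
      algebraic_one := γ.algebraic_zero }
  let κ₁ : CurvePath (⟨2, 1, ![X 0 * X 1 - 1]⟩ : CurveData) :=
    { toFun := fun _ => γ.toFun 1
      contDiffOn := contDiffOn_const
      mem_points := fun _ _ => γ.mem_points 1 h1I
      algebraic_zero := γ.algebraic_one
      algebraic_one := γ.algebraic_one }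
  let E : CurvePath (⟨2, 1, ![X 0 * X 1 - 1]⟩ : CurveData) :=
    { toFun := fun t => H (1, t)
      contDiffOn := (hHC.comp (contDiff_const.prodMk contDiff_id)).contDiffOn
      mem_points := fun t _ => hHmem _
      algebraic_zero := fun i => by
        show IsAlgebraic ℚ (H (1, 0) i)
        rw [hH_s0 1]
        exact γ.algebraic_zero i
      algebraic_one := fun i => by
        show IsAlgebraic ℚ (H (1, 1) i)
        rw [hH_s1 1]
        exact γ.algebraic_one i }
  let δ : CurvePath (⟨2, 1, ![X 0 * X 1 - 1]⟩ : CurveData) :=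
    { toFun := fun t => H (t, t)
      contDiffOn := (hHC.comp (contDiff_id.prodMk contDiff_id)).contDiffOn
      mem_points := fun t _ => hHmem _
      algebraic_zero := fun i => by
        show IsAlgebraic ℚ (H (0, 0) i)
        rw [hH_s0 0]
        exact γ.algebraic_zero i
      algebraic_one := fun i => by
        show IsAlgebraic ℚ (H (1, 1) i)
        rw [hH_s1 1]
        exact γ.algebraic_one i }
  have hτ₁ : ContDiffOn ℝ 1 (fun q : ℝ × ℝ => H (q.1 + q.2, q.2)) stdTriangle :=
    (hHC.comp ((contDiff_fst.add contDiff_snd).prodMk contDiff_snd)).contDiffOn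
  have hτ₂ : ContDiffOn ℝ 1 (fun q : ℝ × ℝ => H (q.1, q.1 + q.2)) stdTriangle :=
    (hHC.comp (contDiff_fst.prodMk (contDiff_fst.add contDiff_snd))).contDiffOn
  have hb₁ := IsElementaryRelation.boundary _ isSmoothAffineCurve_mulGroup ω h
    (fun q : ℝ × ℝ => H (q.1 + q.2, q.2)) hτ₁ (fun q _ => hHmem _) κ₀ E δ
    (fun t _ => by show γ.toFun 0 = H (t + 0, 0); rw [add_zero, hH_s0])
    (fun t _ => by show H (1, t) = H (1 - t + t, t); rw [sub_add_cancel])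
    (fun t _ => by show H (t, t) = H (0 + t, t); rw [zero_add])
  have hb₂ := IsElementaryRelation.boundary _ isSmoothAffineCurve_mulGroup ω h
    (fun q : ℝ × ℝ => H (q.1, q.1 + q.2)) hτ₂ (fun q _ => hHmem _) δ κ₁ γ
    (fun t _ => by show H (t, t) = H (t, t + 0); rw [add_zero])
    (fun t _ => by show γ.toFun 1 = H (1 - t, 1 - t + t); rw [sub_add_cancel, hH_s1])
    (fun t ht => by show γ.toFun t = H (0, 0 + t); rw [zero_add, hH_0t t ht])
  have hκ₀ : IsElementaryRelation (Finsupp.single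
      (⟨⟨2, 1, ![X 0 * X 1 - 1]⟩, isSmoothAffineCurve_mulGroup, ω, h, κ₀⟩ : PeriodSymbol) 1) :=
    isElementaryRelation_single_of_const isSmoothAffineCurve_mulGroup ω h κ₀ (γ.toFun 0)
      fun _ _ => rfl
  have hκ₁ : IsElementaryRelation (Finsupp.single
      (⟨⟨2, 1, ![X 0 * X 1 - 1]⟩, isSmoothAffineCurve_mulGroup, ω, h, κ₁⟩ : PeriodSymbol) 1) :=
    isElementaryRelation_single_of_const isSmoothAffineCurve_mulGroup ω h κ₁ (γ.toFun 1)
      fun _ _ => rfl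
  refine ⟨E, _, _, _, _, fun t => ?_, hb₁, hb₂, hκ₀, hκ₁, ?_⟩
  · show H (1, t) = _
    rw [hH]
    simp only [hℓ_1t]
  · abel

/-- Unconditional form: the `C¹` logarithm is supplied by `exists_contDiff_exp_eq`.
[cite: HuberWustholz2022, §3.3.1 (pp. 42–43)] -/
theorem exists_single_path_eq_single_expPath (ω : Fin 2 → MvPolynomial (Fin 2) ℂ)
    (h : ∀ i, HasAlgCoeffs (ω i)) (γ : CurvePath (⟨2, 1, ![X 0 * X 1 - 1]⟩ : CurveData)) :
    ∃ (L₀ L₁ : ℂ) (E : CurvePath (⟨2, 1, ![X 0 * X 1 - 1]⟩ : CurveData))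
      (ρ₁ ρ₂ ρ₃ ρ₄ : PeriodSymbol →₀ ℂ),
      exp L₀ = γ.toFun 0 0 ∧ exp L₁ = γ.toFun 1 0 ∧
      (∀ t, E.toFun t = ![exp ((1 - t) * L₀ + t * L₁), exp (-((1 - t) * L₀ + t * L₁))]) ∧
      IsElementaryRelation ρ₁ ∧ IsElementaryRelation ρ₂ ∧ IsElementaryRelation ρ₃ ∧
      IsElementaryRelation ρ₄ ∧
      Finsupp.single (⟨⟨2, 1, ![X 0 * X 1 - 1]⟩, isSmoothAffineCurve_mulGroup, ω, h, γ⟩ :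
          PeriodSymbol) (1 : ℂ) =
        Finsupp.single (⟨⟨2, 1, ![X 0 * X 1 - 1]⟩, isSmoothAffineCurve_mulGroup, ω, h, E⟩ :
          PeriodSymbol) (1 : ℂ) + (ρ₃ + ρ₄ - ρ₁ - ρ₂) := by
  have hx : ContDiffOn ℝ 1 (fun t => γ.toFun t 0) (Icc 0 1) := γ.contDiffOn_apply 0
  have hx0 : ∀ t ∈ Icc (0 : ℝ) 1, γ.toFun t 0 ≠ 0 := fun t ht =>
    left_ne_zero_of_mul_eq_one ((mem_points_mulGroup_iff _).1 (γ.mem_points t ht))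
  obtain ⟨L, hLC, _, _, hLexp⟩ := exists_contDiff_exp_eq zero_lt_one hx hx0
  obtain ⟨E, ρ₁, ρ₂, ρ₃, ρ₄, hE, h₁, h₂, h₃, h₄, he⟩ :=
    single_path_eq_single_expPath ω h γ L hLC hLexp
  exact ⟨L 0, L 1, E, ρ₁, ρ₂, ρ₃, ρ₄, hLexp 0 ⟨le_rfl, zero_le_one⟩,
    hLexp 1 ⟨zero_le_one, le_rfl⟩, hE, h₁, h₂, h₃, h₄, he⟩

/-! ### Base change and concatenation of exponential paths -/

/-- **Base change (R4)**: `(y dx, E_{L₀,L₁}) − (y dx, E_{0,L₁−L₀})` is the functoriality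
relation along `(x, y) ↦ (e^{−L₀}x, e^{L₀}y)`. [folklore] -/
theorem rel_expPath_baseChange {L₀ L₁ : ℂ} (h₀ : IsAlgebraic ℚ (exp L₀))
    (E E₀ : CurvePath (⟨2, 1, ![X 0 * X 1 - 1]⟩ : CurveData))
    (hE : ∀ t, E.toFun t = ![exp ((1 - t) * L₀ + t * L₁), exp (-((1 - t) * L₀ + t * L₁))])
    (hE₀ : ∀ t, E₀.toFun t =
      ![exp ((1 - t) * 0 + t * (L₁ - L₀)), exp (-((1 - t) * 0 + t * (L₁ - L₀)))]) :
    IsElementaryRelation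
      (Finsupp.single (⟨⟨2, 1, ![X 0 * X 1 - 1]⟩, isSmoothAffineCurve_mulGroup, ![X 1, 0],
          hasAlgCoeffs_ydx, E⟩ : PeriodSymbol) 1 -
        Finsupp.single (⟨⟨2, 1, ![X 0 * X 1 - 1]⟩, isSmoothAffineCurve_mulGroup, ![X 1, 0],
          hasAlgCoeffs_ydx, E₀⟩ : PeriodSymbol) 1) := by
  set p : ℂ := exp L₀ with hp_def
  have hp0 : p ≠ 0 := exp_ne_zero _
  have hf : ∀ j, HasAlgCoeffs ((![C p⁻¹ * X 0, C p * X 1] : Fin 2 → MvPolynomial (Fin 2) ℂ) j) := by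
    intro j
    fin_cases j
    · simpa using (hasAlgCoeffs_C h₀.inv).mul (hasAlgCoeffs_X (n := 2) 0)
    · simpa using (hasAlgCoeffs_C h₀).mul (hasAlgCoeffs_X (n := 2) 1)
  have hfZ : ∀ z ∈ (⟨2, 1, ![X 0 * X 1 - 1]⟩ : CurveData).points,
      (fun j => eval z ((![C p⁻¹ * X 0, C p * X 1] : Fin 2 → MvPolynomial (Fin 2) ℂ) j)) ∈
        (⟨2, 1, ![X 0 * X 1 - 1]⟩ : CurveData).points := by
    intro z hz
    rw [mem_points_mulGroup_iff] at hz ⊢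
    simp only [Matrix.cons_val_zero, Matrix.cons_val_one, map_mul, eval_C, eval_X]
    calc p⁻¹ * z 0 * (p * z 1) = (p⁻¹ * p) * (z 0 * z 1) := by ring
      _ = 1 := by rw [inv_mul_cancel₀ hp0, hz, one_mul]
  have hpull : formPullback (![C p⁻¹ * X 0, C p * X 1] : Fin 2 → MvPolynomial (Fin 2) ℂ)
      ![X 1, 0] = ![X 1, 0] := by
    funext i
    fin_cases i
    · simp only [formPullback, Fin.sum_univ_two, Matrix.cons_val_zero, Matrix.cons_val_one,
        bind₁_X_right, map_zero, zero_mul, add_zero, Fin.zero_eta, pderiv_mul, pderiv_C,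
        pderiv_X_self, mul_one]
      rw [zero_add, mul_comm (C p) (X 1), mul_assoc, ← C_mul, mul_inv_cancel₀ hp0, C_1, mul_one]
    · simp [formPullback, Fin.sum_univ_two, pderiv_X]
  have key := IsElementaryRelation.pushforward _ _ isSmoothAffineCurve_mulGroup
    isSmoothAffineCurve_mulGroup (![C p⁻¹ * X 0, C p * X 1]) hf hfZ ![X 1, 0] hasAlgCoeffs_ydx
    (formPullback (![C p⁻¹ * X 0, C p * X 1] : Fin 2 → MvPolynomial (Fin 2) ℂ) ![X 1, 0])
    (fun i => by rw [hpull]; exact hasAlgCoeffs_ydx i) rfl E E₀ (fun t _ => by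
      rw [hE₀, hE]
      funext j
      fin_cases j
      · show exp ((1 - (t : ℂ)) * 0 + (t : ℂ) * (L₁ - L₀)) =
          eval (![exp ((1 - (t : ℂ)) * L₀ + (t : ℂ) * L₁),
            exp (-((1 - (t : ℂ)) * L₀ + (t : ℂ) * L₁))] : Fin 2 → ℂ) (C p⁻¹ * X 0)
        rw [map_mul, eval_C, eval_X, Matrix.cons_val_zero, hp_def, ← exp_neg, ← exp_add]
        congr 1
        ring
      · show exp (-((1 - (t : ℂ)) * 0 + (t : ℂ) * (L₁ - L₀))) =
          eval (![exp ((1 - (t : ℂ)) * L₀ + (t : ℂ) * L₁),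
            exp (-((1 - (t : ℂ)) * L₀ + (t : ℂ) * L₁))] : Fin 2 → ℂ) (C p * X 1)
        rw [map_mul, eval_C, eval_X, Matrix.cons_val_one, Matrix.cons_val_zero, hp_def, ← exp_add]
        congr 1
        ring)
  rwa [PeriodSymbol.mk_eq_mk isSmoothAffineCurve_mulGroup _ hasAlgCoeffs_ydx E hpull] at key

/-- **Concatenation (R5)**: for `e^A, e^B ∈ ℚ̄`, `E_{0,A} + E_{A,A+B} − E_{0,A+B}` is the
boundary of the smooth triangle `(a, b) ↦ (e^{aA + b(A+B)}, e^{−aA − b(A+B)})`. [folklore] -/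
theorem rel_expPath_concat {A B : ℂ} (ω : Fin 2 → MvPolynomial (Fin 2) ℂ)
    (h : ∀ i, HasAlgCoeffs (ω i))
    (E₁ E₂ E₃ : CurvePath (⟨2, 1, ![X 0 * X 1 - 1]⟩ : CurveData))
    (hE₁ : ∀ t, E₁.toFun t = ![exp ((1 - t) * 0 + t * A), exp (-((1 - t) * 0 + t * A))])
    (hE₂ : ∀ t, E₂.toFun t =
      ![exp ((1 - t) * A + t * (A + B)), exp (-((1 - t) * A + t * (A + B)))])
    (hE₃ : ∀ t, E₃.toFun t =
      ![exp ((1 - t) * 0 + t * (A + B)), exp (-((1 - t) * 0 + t * (A + B)))]) :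
    IsElementaryRelation
      (Finsupp.single (⟨⟨2, 1, ![X 0 * X 1 - 1]⟩, isSmoothAffineCurve_mulGroup, ω, h, E₁⟩ :
          PeriodSymbol) 1 +
        Finsupp.single (⟨⟨2, 1, ![X 0 * X 1 - 1]⟩, isSmoothAffineCurve_mulGroup, ω, h, E₂⟩ :
          PeriodSymbol) 1 -
        Finsupp.single (⟨⟨2, 1, ![X 0 * X 1 - 1]⟩, isSmoothAffineCurve_mulGroup, ω, h, E₃⟩ :
          PeriodSymbol) 1) := by
  obtain ⟨ℓ, hℓ⟩ : ∃ ℓ : ℝ × ℝ → ℂ, ℓ = fun q => (q.1 : ℂ) * A + (q.2 : ℂ) * (A + B) :=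
    ⟨_, rfl⟩
  have hℓC : ContDiff ℝ 1 ℓ := by
    rw [hℓ]
    exact ((ofRealCLM.contDiff.comp contDiff_fst).mul contDiff_const).add
      ((ofRealCLM.contDiff.comp contDiff_snd).mul contDiff_const)
  obtain ⟨τ, hτ⟩ : ∃ τ : ℝ × ℝ → (Fin 2 → ℂ), τ = fun q => ![exp (ℓ q), exp (-ℓ q)] :=
    ⟨_, rfl⟩
  have hτC : ContDiff ℝ 1 τ := by
    rw [hτ]
    refine contDiff_pi.2 fun i => ?_
    fin_cases i
    · simpa using hℓC.cexp
    · simpa using hℓC.neg.cexp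
  have hτmem : ∀ q, τ q ∈ (⟨2, 1, ![X 0 * X 1 - 1]⟩ : CurveData).points := fun q => by
    rw [hτ, mem_points_mulGroup_iff]
    simp only [Matrix.cons_val_zero, Matrix.cons_val_one]
    rw [← exp_add, add_neg_cancel, exp_zero]
  refine IsElementaryRelation.boundary _ isSmoothAffineCurve_mulGroup ω h τ hτC.contDiffOn
    (fun q _ => hτmem q) E₁ E₂ E₃ (fun t _ => ?_) (fun t _ => ?_) (fun t _ => ?_)
  · rw [hE₁, hτ, hℓ]
    dsimp only
    have : (1 - (t : ℂ)) * 0 + (t : ℂ) * A = (t : ℂ) * A + ((0 : ℝ) : ℂ) * (A + B) := by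
      push_cast; ring
    rw [this]
  · rw [hE₂, hτ, hℓ]
    dsimp only
    have : (1 - (t : ℂ)) * A + (t : ℂ) * (A + B) = ((1 - t : ℝ) : ℂ) * A + (t : ℂ) * (A + B) := by
      push_cast; ring
    rw [this]
  · rw [hE₃, hτ, hℓ]
    dsimp only
    have : (1 - (t : ℂ)) * 0 + (t : ℂ) * (A + B) = ((0 : ℝ) : ℂ) * A + (t : ℂ) * (A + B) := by
      push_cast; ring
    rw [this]

/-! ### The calculus of logarithm symbols

A *logarithm symbol* is `(𝔾ₘ, y dx, E)` for an exponential path `E = E_{0,M}` (`e^M ∈ ℚ̄`); its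
period is `M`, a logarithm of the algebraic number `e^M`. Modulo the `ℚ̄`-span of the
elementary relations these symbols are additive and `ℚ`-linear in `M`. -/

section LogSymbols

local notation3 "InSpanRel " c:arg => ∃ (k : ℕ) (ρ : Fin k → (PeriodSymbol →₀ ℂ))
  (a : Fin k → ℂ), (∀ l, IsElementaryRelation (ρ l)) ∧ (∀ l, IsAlgebraic ℚ (a l)) ∧
    c = ∑ l, a l • ρ l

local notation3 "logSym " E:arg => (⟨⟨2, 1, ![X 0 * X 1 - 1]⟩, isSmoothAffineCurve_mulGroup,
  ![X 1, 0], hasAlgCoeffs_ydx, E⟩ : PeriodSymbol)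

/-- `e^0` is algebraic. [folklore] -/
theorem isAlgebraic_exp_zero : IsAlgebraic ℚ (exp 0) := by
  rw [exp_zero]; exact isAlgebraic_one

/-- `e^{nM}` is algebraic when `e^M` is. [folklore] -/
theorem isAlgebraic_exp_nat_mul {M : ℂ} (hM : IsAlgebraic ℚ (exp M)) (n : ℕ) :
    IsAlgebraic ℚ (exp ((n : ℂ) * M)) := by
  rw [exp_nat_mul]; exact hM.pow n

/-- `e^{aM}` is algebraic when `e^M` is, `a ∈ ℤ`. [folklore] -/
theorem isAlgebraic_exp_int_mul {M : ℂ} (hM : IsAlgebraic ℚ (exp M)) (a : ℤ) :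
    IsAlgebraic ℚ (exp ((a : ℂ) * M)) := by
  obtain ⟨n, rfl | rfl⟩ := Int.eq_nat_or_neg a
  · simpa using isAlgebraic_exp_nat_mul hM n
  · have h : exp (((-(n : ℤ) : ℤ) : ℂ) * M) = (exp ((n : ℂ) * M))⁻¹ := by
      rw [← exp_neg]; congr 1; push_cast; ring
    rw [h]
    exact (isAlgebraic_exp_nat_mul hM n).inv

/-- `e^{qM}` is algebraic when `e^M` is, `q ∈ ℚ` (a root of an integer power). [folklore] -/
theorem isAlgebraic_exp_rat_mul {M : ℂ} (hM : IsAlgebraic ℚ (exp M)) (q : ℚ) :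
    IsAlgebraic ℚ (exp ((q : ℂ) * M)) := by
  refine IsAlgebraic.of_pow q.den_pos ?_
  rw [← exp_nat_mul]
  have h : (q.den : ℂ) * ((q : ℂ) * M) = ((q.num : ℤ) : ℂ) * M := by
    rw [← mul_assoc]
    congr 1
    have := Rat.mul_den_eq_num q
    rw [mul_comm]
    exact_mod_cast this
  rw [h]
  exact isAlgebraic_exp_int_mul hM q.num

/-- **A logarithm symbol of `0` is an elementary relation** (its path is constant).
[folklore] -/
theorem rel_logSym_zero (E : CurvePath (⟨2, 1, ![X 0 * X 1 - 1]⟩ : CurveData))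
    (hE : ∀ t, E.toFun t = ![exp ((1 - t) * 0 + t * 0), exp (-((1 - t) * 0 + t * 0))]) :
    IsElementaryRelation (Finsupp.single (logSym E) 1) :=
  isElementaryRelation_single_of_const isSmoothAffineCurve_mulGroup _ hasAlgCoeffs_ydx E ![1, 1]
    fun t _ => by rw [hE]; simp

/-- **Additivity of logarithm symbols**: `ℓ(A) + ℓ(B) − ℓ(A + B)` lies in the `ℚ̄`-span of the
elementary relations (concatenation (R5) and base change (R4)). [folklore] -/
theorem span_logSym_add {A B : ℂ} (hA : IsAlgebraic ℚ (exp A)) (hB : IsAlgebraic ℚ (exp B))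
    (EA EB EAB : CurvePath (⟨2, 1, ![X 0 * X 1 - 1]⟩ : CurveData))
    (hEA : ∀ t, EA.toFun t = ![exp ((1 - t) * 0 + t * A), exp (-((1 - t) * 0 + t * A))])
    (hEB : ∀ t, EB.toFun t = ![exp ((1 - t) * 0 + t * B), exp (-((1 - t) * 0 + t * B))])
    (hEAB : ∀ t, EAB.toFun t =
      ![exp ((1 - t) * 0 + t * (A + B)), exp (-((1 - t) * 0 + t * (A + B)))]) :
    InSpanRel (Finsupp.single (logSym EA) 1 + Finsupp.single (logSym EB) 1 -
      Finsupp.single (logSym EAB) 1) := by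
  have hAB : IsAlgebraic ℚ (exp (A + B)) := by rw [exp_add]; exact hA.mul hB
  obtain ⟨E₂, hE₂⟩ := exists_expPath (L₀ := A) (L₁ := A + B) hA hAB
  have r₁ := rel_expPath_concat ![X 1, 0] hasAlgCoeffs_ydx EA E₂ EAB hEA hE₂ hEAB
  obtain ⟨E₀, hE₀⟩ := exists_expPath (L₀ := 0) (L₁ := (A + B) - A) isAlgebraic_exp_zero
    (by rw [add_sub_cancel_left]; exact hB)
  have r₂ := rel_expPath_baseChange hA E₂ E₀ hE₂ hE₀
  have hEq : E₀ = EB := CurvePath.eq_of_toFun_eq fun t => by rw [hE₀, hEB, add_sub_cancel_left]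
  rw [hEq] at r₂
  obtain ⟨k, ρ, a, hρ, ha, he⟩ := span_sub (span_of_rel r₁) (span_of_rel r₂)
  exact ⟨k, ρ, a, hρ, ha, by rw [← he]; abel⟩

/-- **`ℓ(nM) ∼ n ℓ(M)`** for `n ∈ ℕ`. [folklore] -/
theorem span_logSym_natMul {M : ℂ} (hM : IsAlgebraic ℚ (exp M)) (n : ℕ)
    (E En : CurvePath (⟨2, 1, ![X 0 * X 1 - 1]⟩ : CurveData))
    (hE : ∀ t, E.toFun t = ![exp ((1 - t) * 0 + t * M), exp (-((1 - t) * 0 + t * M))])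
    (hEn : ∀ t, En.toFun t =
      ![exp ((1 - t) * 0 + t * ((n : ℂ) * M)), exp (-((1 - t) * 0 + t * ((n : ℂ) * M)))]) :
    InSpanRel (Finsupp.single (logSym En) 1 - (n : ℂ) • Finsupp.single (logSym E) 1) := by
  induction n generalizing En with
  | zero =>
    have hEn' : ∀ t, En.toFun t = ![exp ((1 - t) * 0 + t * 0), exp (-((1 - t) * 0 + t * 0))] :=
      fun t => by rw [hEn]; push_cast; ring_nf
    obtain ⟨k, ρ, a, hρ, ha, he⟩ := span_of_rel (rel_logSym_zero En hEn')
    exact ⟨k, ρ, a, hρ, ha, by rw [← he]; simp⟩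
  | succ n ih =>
    obtain ⟨En', hEn'⟩ := exists_expPath (L₀ := 0) (L₁ := (n : ℂ) * M) isAlgebraic_exp_zero
      (isAlgebraic_exp_nat_mul hM n)
    have hEn'' : ∀ t, En.toFun t = ![exp ((1 - t) * 0 + t * ((n : ℂ) * M + M)),
        exp (-((1 - t) * 0 + t * ((n : ℂ) * M + M)))] := fun t => by
      rw [hEn]; push_cast; ring_nf
    have hadd := span_logSym_add (isAlgebraic_exp_nat_mul hM n) hM En' E En hEn' hE hEn''
    have hih := ih En' hEn'
    obtain ⟨k, ρ, a, hρ, ha, he⟩ := span_add (span_smul (isAlgebraic_one.neg) hadd) hih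
    exact ⟨k, ρ, a, hρ, ha, by rw [← he, Nat.cast_succ, add_smul, one_smul, neg_one_smul]; abel⟩

/-- **`ℓ(−M) + ℓ(M) ∼ 0`**. [folklore] -/
theorem span_logSym_neg {M : ℂ} (hM : IsAlgebraic ℚ (exp M))
    (E Em : CurvePath (⟨2, 1, ![X 0 * X 1 - 1]⟩ : CurveData))
    (hE : ∀ t, E.toFun t = ![exp ((1 - t) * 0 + t * M), exp (-((1 - t) * 0 + t * M))])
    (hEm : ∀ t, Em.toFun t = ![exp ((1 - t) * 0 + t * -M), exp (-((1 - t) * 0 + t * -M))]) :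
    InSpanRel (Finsupp.single (logSym Em) 1 + Finsupp.single (logSym E) 1) := by
  have hm : IsAlgebraic ℚ (exp (-M)) := by rw [exp_neg]; exact hM.inv
  obtain ⟨E0, hE0⟩ := exists_expPath (L₀ := 0) (L₁ := M + -M) isAlgebraic_exp_zero
    (by rw [add_neg_cancel]; exact isAlgebraic_exp_zero)
  have hadd := span_logSym_add hM hm E Em E0 hE hEm hE0
  have hE0' : ∀ t, E0.toFun t = ![exp ((1 - t) * 0 + t * 0), exp (-((1 - t) * 0 + t * 0))] :=
    fun t => by rw [hE0, add_neg_cancel]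
  have r0 := rel_logSym_zero E0 hE0'
  obtain ⟨k, ρ, a, hρ, ha, he⟩ := span_add hadd (span_of_rel r0)
  exact ⟨k, ρ, a, hρ, ha, by rw [← he]; abel⟩

/-- **`ℓ(aM) ∼ a ℓ(M)`** for `a ∈ ℤ`. [folklore] -/
theorem span_logSym_intMul {M : ℂ} (hM : IsAlgebraic ℚ (exp M)) (a : ℤ)
    (E Ea : CurvePath (⟨2, 1, ![X 0 * X 1 - 1]⟩ : CurveData))
    (hE : ∀ t, E.toFun t = ![exp ((1 - t) * 0 + t * M), exp (-((1 - t) * 0 + t * M))])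
    (hEa : ∀ t, Ea.toFun t =
      ![exp ((1 - t) * 0 + t * ((a : ℂ) * M)), exp (-((1 - t) * 0 + t * ((a : ℂ) * M)))]) :
    InSpanRel (Finsupp.single (logSym Ea) 1 - (a : ℂ) • Finsupp.single (logSym E) 1) := by
  obtain ⟨n, rfl | rfl⟩ := Int.eq_nat_or_neg a
  · have h := span_logSym_natMul hM n E Ea hE (fun t => by rw [hEa]; push_cast; ring_nf)
    simpa using h
  · -- `ℓ(−nM) ∼ −ℓ(nM) ∼ −n ℓ(M)`
    obtain ⟨En, hEn⟩ := exists_expPath (L₀ := 0) (L₁ := (n : ℂ) * M) isAlgebraic_exp_zero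
      (isAlgebraic_exp_nat_mul hM n)
    have hneg := span_logSym_neg (isAlgebraic_exp_nat_mul hM n) En Ea hEn
      (fun t => by rw [hEa]; push_cast; ring_nf)
    have hnat := span_logSym_natMul hM n E En hE hEn
    obtain ⟨k, ρ, c, hρ, hc, he⟩ := span_sub hneg hnat
    refine ⟨k, ρ, c, hρ, hc, ?_⟩
    rw [← he]
    push_cast
    rw [neg_smul]
    abel

/-- **`ℓ(qM) ∼ q ℓ(M)`** for `q ∈ ℚ` (from `den(q) · ℓ(qM) ∼ ℓ(num(q) M) ∼ num(q) ℓ(M)`).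
[folklore] -/
theorem span_logSym_ratMul {M : ℂ} (hM : IsAlgebraic ℚ (exp M)) (q : ℚ)
    (E Eq : CurvePath (⟨2, 1, ![X 0 * X 1 - 1]⟩ : CurveData))
    (hE : ∀ t, E.toFun t = ![exp ((1 - t) * 0 + t * M), exp (-((1 - t) * 0 + t * M))])
    (hEq : ∀ t, Eq.toFun t =
      ![exp ((1 - t) * 0 + t * ((q : ℂ) * M)), exp (-((1 - t) * 0 + t * ((q : ℂ) * M)))]) :
    InSpanRel (Finsupp.single (logSym Eq) 1 - (q : ℂ) • Finsupp.single (logSym E) 1) := by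
  have hqM : IsAlgebraic ℚ (exp ((q : ℂ) * M)) := isAlgebraic_exp_rat_mul hM q
  -- the path for `num(q) M = den(q) (q M)`
  obtain ⟨Ea, hEa⟩ := exists_expPath (L₀ := 0) (L₁ := ((q.num : ℤ) : ℂ) * M)
    isAlgebraic_exp_zero (isAlgebraic_exp_int_mul hM q.num)
  have hden : ((q.den : ℕ) : ℂ) * ((q : ℂ) * M) = ((q.num : ℤ) : ℂ) * M := by
    rw [← mul_assoc]
    congr 1
    have := Rat.mul_den_eq_num q
    rw [mul_comm]
    exact_mod_cast this
  have h₁ := span_logSym_natMul hqM q.den Eq Ea hEq (fun t => by rw [hEa, hden])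
  have h₂ := span_logSym_intMul hM q.num E Ea hE hEa
  -- `den • ℓ(qM) ∼ num • ℓ(M)`, divide by `den`
  have hd0 : ((q.den : ℕ) : ℂ) ≠ 0 := by exact_mod_cast q.den_pos.ne'
  have hdinv : IsAlgebraic ℚ (((q.den : ℕ) : ℂ)⁻¹) := (isAlgebraic_nat q.den).inv
  obtain ⟨k, ρ, c, hρ, hc, he⟩ := span_smul hdinv (span_sub h₂ h₁)
  refine ⟨k, ρ, c, hρ, hc, ?_⟩
  rw [← he, smul_sub, smul_sub, smul_sub, smul_smul, smul_smul, inv_mul_cancel₀ hd0, one_smul]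
  have hq : (((q.den : ℕ) : ℂ)⁻¹ * ((q.num : ℤ) : ℂ)) = (q : ℂ) := by
    rw [inv_mul_eq_div, Rat.cast_def]
  rw [hq]
  abel

end LogSymbols

end CurvePeriods

end Literature.NumberTheory.Transcendental

end
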